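import Summits.AtomisticToContinuum.BoseEinsteinCondensation.Theorems.BECInsertionCorrectorCorrectorClosureHoleModeEquation
import HarnessLib

/-!
# Line `insertion-mode-gaussian-domination`, aux `holeMode_coercive_bound` — above the chemical potential the hole-mode
# equation is coercive: `L²(Θ₀²)` mass and Dirichlet energy of both hole quadratures are bounded by the interaction vertex
# alone (crux `BECInsertionCorrector.CorrectorClosure`, item stmt-AtomisticToContinuum-12058; supports, does not close)

The exact weak hole-mode equation of the Feynman–Kac ground-state pair (`holeMode_weakEquation`, p150790) reads, for the
quadratures `c = Re a(φ_n)Φ₀/Θ₀`, `s = Im a(φ_n)Φ₀/Θ₀` of the hole state and every periodic test `φ`,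
`𝓔_Θ₀(c, φ) + (|p|² − μ_N) ∫ c φ Θ₀² = −∫ T_c φ Θ₀²`, `T_c = Re a(φ_n)(WΦ₀)/Θ₀`, `μ_N = E₀(N+1) − E₀(N)`.
In the COERCIVE regime `|p|² > μ_N` (the upper part of the mode-count window; heart dossier
`Cruxes/CorrectorClosure/Lines/insertion-mode-gaussian-domination-heart.md` §2) testing with `φ = c` itself (a periodic
`C¹` test: `Φ₀, Θ₀ ∈ C¹`, `Θ₀ > 0`) and dropping `𝓔 ≥ 0` gives, for every `τ ≥ 0` dominating the `L²(Θ₀²)` pairing with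
the vertex (`|∫ T_c φ Θ₀²| ≤ τ (∫ φ² Θ₀²)^{1/2}` on tests),

  `(|p|² − μ_N)² ∫ c² Θ₀² ≤ τ²`   and   `4 (|p|² − μ_N) 𝓔_Θ₀(c, c) ≤ τ²`   (same for `s`):

the occupation `n_n = ∫ (c² + s²) Θ₀²` and the Dirichlet energy of the hole mode above the chemical potential are
controlled by the vertex norm `τ² ≍ ‖a(φ_n)(WΦ₀)‖²` with NO infrared input, NO Kennedy–Lieb–Shastry step and NO `H₋₁`
norm — what is left there is an intensive ("marked structure factor") bound on `τ`. Below `μ_N` the operator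
`−G_N + |p|² − μ_N` is indefinite and this file says nothing.
References (shape only): M. Reed, B. Simon, *Methods of Modern Mathematical Physics IV*, §XIII.1; T. Kennedy,
E. H. Lieb, B. S. Shastry, J. Stat. Phys. 53 (1988) 1019, (12)–(14) (the step this bound bypasses above `μ_N`).
-/

noncomputable section

namespace Summit.AtomisticToContinuum.BoseEinsteinCondensation.Theorems.CorrectorClosure.InsertionModeGaussianDomination

open MeasureTheory Filter Matrix
open scoped ENNReal NNReal BigOperators ComplexConjugate
open Literature.MathematicalPhysics.QuantumManyBody.BoseGas
open Summit.AtomisticToContinuum.BoseEinsteinCondensation.Cruxes.HardCoreExtension.ThirdLawCurrentFloor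
  (stub_periodicGroundStateRegularity)

variable {N : ℕ}

/-- The real core: if `0 ≤ E`, `0 ≤ X`, `0 < a`, `0 ≤ τ` and `E + aX ≤ τ√X`, then `a²X ≤ τ²` and `4aE ≤ τ²`
(divide by `√X`; complete the square `τ√X − aX ≤ τ²/(4a)`). [folklore] -/
theorem coercive_core {E X a τ : ℝ} (hE : 0 ≤ E) (hX : 0 ≤ X) (ha : 0 < a) (hτ : 0 ≤ τ)
    (h : E + a * X ≤ τ * Real.sqrt X) : a ^ 2 * X ≤ τ ^ 2 ∧ 4 * a * E ≤ τ ^ 2 := by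
  set r : ℝ := Real.sqrt X with hr
  have hr0 : 0 ≤ r := Real.sqrt_nonneg X
  have hrX : r ^ 2 = X := Real.sq_sqrt hX
  rw [← hrX] at h ⊢
  have h1 : a * r ≤ τ := by
    by_contra hlt
    rw [not_le] at hlt
    -- then `r > 0` and `a r² > τ r ≥ E + a r² - ...`: contradiction
    have hrpos : 0 < r := by
      rcases hr0.lt_or_eq with h0 | h0
      · exact h0
      · rw [← h0, mul_zero] at hlt; linarith
    nlinarith [mul_lt_mul_of_pos_right hlt hrpos]
  constructor
  · have h2 : 0 ≤ a * r := mul_nonneg ha.le hr0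
    nlinarith [mul_le_mul h1 h1 h2 hτ]
  · nlinarith [sq_nonneg (2 * a * r - τ)]

/-- **Aux `holeMode_coercive_bound` — coercive hole-mode bound above the chemical potential.** For a repulsive
finite-range `v` with bounded periodisation on the torus of side `L > 0`, the positive FK ground states `Θ₀` (`N ≥ 1`
bodies) and `Φ₀` (`N+1` bodies), a mode `n` with `|p|² > μ_N := E₀(N+1) − E₀(N)` (`p = 2πn/L`) and any `τ ≥ 0` bounding
the `L²(Θ₀²)` pairing of the interaction vertex `T = Re a(φ_n)(WΦ₀)/Θ₀` (resp. `Im`) with periodic tests,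
`|∫ T φ Θ₀²| ≤ τ (∫ φ² Θ₀²)^{1/2}`: the quadrature `c = Re a(φ_n)Φ₀/Θ₀` (resp. `Im`) obeys
`(|p|² − μ_N)² ∫ c² Θ₀² ≤ τ²` and `4(|p|² − μ_N) 𝓔_Θ₀(c, c) ≤ τ²`. [cite: ReedSimonIV1978, §XIII.1 (Rayleigh–Ritz)] -/
theorem holeMode_coercive_bound (v : ℝ → ℝ≥0∞) (hv : IsRepulsiveFiniteRange v) (N : ℕ) (hN : 1 ≤ N) (L : ℝ)
    (hL : 0 < L) (hb : ∃ C : ℝ≥0, ∀ x, periodizedPotential v L x ≤ C)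
    (Θ₀ : Config N → ℝ) (hΘ : IsPeriodicGroundStateFK v L Θ₀) (hΘp : ∀ X, 0 < Θ₀ X)
    (Φ₀ : Config (N + 1) → ℝ) (hΦ : IsPeriodicGroundStateFK v L Φ₀) (hΦp : ∀ X, 0 < Φ₀ X)
    (n : Fin 3 → ℤ)
    (hμ : (periodicGroundStateEnergy v (N + 1) L).toReal - (periodicGroundStateEnergy v N L).toReal <
      ‖latticeVec (2 * Real.pi / L) n‖ ^ 2)
    (τ : ℝ) (hτ : 0 ≤ τ) :
    ((∀ φ : Config N → ℝ, IsPeriodicTest L φ →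
        |∫ Y in cellN N L, (modeAn L (planeWaveMode L n)
            (fun X => ((∑ j : Fin N, (periodizedPotential v L (X 0 - X j.succ)).toReal) * Φ₀ X : ℂ)) Y).re
            / Θ₀ Y * φ Y * Θ₀ Y ^ 2| ≤
          τ * Real.sqrt (∫ Y in cellN N L, φ Y * φ Y * Θ₀ Y ^ 2)) →
      (‖latticeVec (2 * Real.pi / L) n‖ ^ 2
          - ((periodicGroundStateEnergy v (N + 1) L).toReal - (periodicGroundStateEnergy v N L).toReal)) ^ 2 *
          ∫ Y in cellN N L, (modeAn L (planeWaveMode L n) (fun X => (Φ₀ X : ℂ)) Y).re / Θ₀ Y *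
            ((modeAn L (planeWaveMode L n) (fun X => (Φ₀ X : ℂ)) Y).re / Θ₀ Y) * Θ₀ Y ^ 2 ≤ τ ^ 2 ∧
      4 * (‖latticeVec (2 * Real.pi / L) n‖ ^ 2
          - ((periodicGroundStateEnergy v (N + 1) L).toReal - (periodicGroundStateEnergy v N L).toReal)) *
          dirichletFormW L Θ₀ (fun Y => (modeAn L (planeWaveMode L n) (fun X => (Φ₀ X : ℂ)) Y).re / Θ₀ Y)
            (fun Y => (modeAn L (planeWaveMode L n) (fun X => (Φ₀ X : ℂ)) Y).re / Θ₀ Y) ≤ τ ^ 2) ∧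
    ((∀ φ : Config N → ℝ, IsPeriodicTest L φ →
        |∫ Y in cellN N L, (modeAn L (planeWaveMode L n)
            (fun X => ((∑ j : Fin N, (periodizedPotential v L (X 0 - X j.succ)).toReal) * Φ₀ X : ℂ)) Y).im
            / Θ₀ Y * φ Y * Θ₀ Y ^ 2| ≤
          τ * Real.sqrt (∫ Y in cellN N L, φ Y * φ Y * Θ₀ Y ^ 2)) →
      (‖latticeVec (2 * Real.pi / L) n‖ ^ 2
          - ((periodicGroundStateEnergy v (N + 1) L).toReal - (periodicGroundStateEnergy v N L).toReal)) ^ 2 *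
          ∫ Y in cellN N L, (modeAn L (planeWaveMode L n) (fun X => (Φ₀ X : ℂ)) Y).im / Θ₀ Y *
            ((modeAn L (planeWaveMode L n) (fun X => (Φ₀ X : ℂ)) Y).im / Θ₀ Y) * Θ₀ Y ^ 2 ≤ τ ^ 2 ∧
      4 * (‖latticeVec (2 * Real.pi / L) n‖ ^ 2
          - ((periodicGroundStateEnergy v (N + 1) L).toReal - (periodicGroundStateEnergy v N L).toReal)) *
          dirichletFormW L Θ₀ (fun Y => (modeAn L (planeWaveMode L n) (fun X => (Φ₀ X : ℂ)) Y).im / Θ₀ Y)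
            (fun Y => (modeAn L (planeWaveMode L n) (fun X => (Φ₀ X : ℂ)) Y).im / Θ₀ Y) ≤ τ ^ 2) := by
  obtain ⟨C, hC⟩ := hb
  have hw : Measurable v := hv.1
  have hΘC1 : ContDiff ℝ 1 Θ₀ := stub_periodicGroundStateRegularity N L v hN hL hw ⟨C, hC⟩ Θ₀ hΘ
  have hΦC1 : ContDiff ℝ 1 Φ₀ :=
    stub_periodicGroundStateRegularity (N + 1) L v (Nat.le_add_left 1 N) hL hw ⟨C, hC⟩ Φ₀ hΦ
  have hΘne : ∀ Y, Θ₀ Y ≠ 0 := fun Y => (hΘp Y).ne'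
  obtain ⟨⟨hreC1, hreP⟩, himC1, himP⟩ := regular_re_im_modeAn (L := L) hΦC1 hΦ.periodic n
  -- the two quadratures are periodic tests
  set c : Config N → ℝ := fun Y => (modeAn L (planeWaveMode L n) (fun X => (Φ₀ X : ℂ)) Y).re / Θ₀ Y
    with hc_def
  set s : Config N → ℝ := fun Y => (modeAn L (planeWaveMode L n) (fun X => (Φ₀ X : ℂ)) Y).im / Θ₀ Y
    with hs_def
  have hcT : IsPeriodicTest L c :=
    ⟨hreC1.div hΘC1 hΘne, fun Y i k => by
      simp only [hc_def]; rw [hΘ.periodic Y i k]; exact congrArg (· / Θ₀ Y) (hreP Y i k)⟩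
  have hsT : IsPeriodicTest L s :=
    ⟨himC1.div hΘC1 hΘne, fun Y i k => by
      simp only [hs_def]; rw [hΘ.periodic Y i k]; exact congrArg (· / Θ₀ Y) (himP Y i k)⟩
  -- the weak equation tested with the quadratures themselves
  have hEqc := (holeMode_weakEquation v hv N hN L hL ⟨C, hC⟩ Θ₀ hΘ hΘp Φ₀ hΦ hΦp n c hcT).1
  have hEqs := (holeMode_weakEquation v hv N hN L hL ⟨C, hC⟩ Θ₀ hΘ hΘp Φ₀ hΦ hΦp n s hsT).2
  set a : ℝ := ‖latticeVec (2 * Real.pi / L) n‖ ^ 2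
      - ((periodicGroundStateEnergy v (N + 1) L).toReal - (periodicGroundStateEnergy v N L).toReal)
    with ha_def
  have ha : 0 < a := by rw [ha_def]; linarith
  have hXc : 0 ≤ ∫ Y in cellN N L, c Y * c Y * Θ₀ Y ^ 2 :=
    integral_nonneg fun Y => mul_nonneg (mul_self_nonneg _) (sq_nonneg _)
  have hXs : 0 ≤ ∫ Y in cellN N L, s Y * s Y * Θ₀ Y ^ 2 :=
    integral_nonneg fun Y => mul_nonneg (mul_self_nonneg _) (sq_nonneg _)
  refine ⟨fun hT => ?_, fun hT => ?_⟩
  · have hTc := hT c hcT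
    have hle : dirichletFormW L Θ₀ c c + a * ∫ Y in cellN N L, c Y * c Y * Θ₀ Y ^ 2 ≤
        τ * Real.sqrt (∫ Y in cellN N L, c Y * c Y * Θ₀ Y ^ 2) := by
      rw [ha_def, hEqc]
      exact (neg_le_abs _).trans hTc
    exact coercive_core (dirichletFormW_self_nonneg L Θ₀ c) hXc ha hτ hle
  · have hTs := hT s hsT
    have hle : dirichletFormW L Θ₀ s s + a * ∫ Y in cellN N L, s Y * s Y * Θ₀ Y ^ 2 ≤
        τ * Real.sqrt (∫ Y in cellN N L, s Y * s Y * Θ₀ Y ^ 2) := by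
      rw [ha_def, hEqs]
      exact (neg_le_abs _).trans hTs
    exact coercive_core (dirichletFormW_self_nonneg L Θ₀ s) hXs ha hτ hle

end Summit.AtomisticToContinuum.BoseEinsteinCondensation.Theorems.CorrectorClosure.InsertionModeGaussianDomination

end
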